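import Summits.QuantumFields.YangMills.Theorems.SmallCircleAnchorAnchorGapStubDebyeScreening20

/-!
# Crux `AnchorGap` (stmt-QuantumFields-11141), line `registered` — tools for iterating the decoupling step (B1/B2 under stub X₀)

Three generic facts needed to iterate `gaussian_decoupling_step` (`…StubDebyeScreening20`) into
the inductive Glimm–Jaffe–Spencer expansion (Brydges 1978 §3, (3.14)–(3.17)), where later
interpolations act on the covariance legs produced by earlier ones and decoupled factors must be
recognised as expectations of the smaller region alone:

* `hasDerivAt_matrix_inv_linear` — `d/ds (A + sD)⁻¹_{pq} = −((A+s₀D)⁻¹ D (A+s₀D)⁻¹)_{pq}` at an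
  invertible point (resolvent identity + continuity of the inverse);
* `gaussian_integral_factorizes_explicit` — the block factorisation of `…20` in explicit product
  form over `(S → ℝ) × (Sᶜ → ℝ)`;
* `gaussian_expect_local` — for two positive definite `S`-block-diagonal precision matrices that
  agree on `S × S`, the expectations of every `S`-local observable coincide (the marginal on a
  decoupled block is the block's own Gaussian): polymer activities depend only on the polymer.
-/

set_option autoImplicit false

noncomputable section

namespace Summit.QuantumFields.YangMills.Theorems.AnchorGap

open MeasureTheory Finset Matrix Filter
open scoped Topology

/-- **Derivative of the inverse along a linear matrix family.** If `A + s₀D` is invertible then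
`s ↦ (A + sD)⁻¹_{pq}` has derivative `−((A+s₀D)⁻¹ D (A+s₀D)⁻¹)_{pq}` at `s₀` (resolvent identity
`(A+sD)⁻¹ − (A+s₀D)⁻¹ = −(s−s₀)(A+sD)⁻¹D(A+s₀D)⁻¹` near `s₀` and continuity of the inverse):
`dC/ds = −C D C` for the covariance along a decoupling interpolation. [folklore] -/
theorem hasDerivAt_matrix_inv_linear :
    ∀ (ι : Type) [Fintype ι] [DecidableEq ι] (A D : Matrix ι ι ℝ) (s₀ : ℝ), IsUnit (A + s₀ • D).det → ∀ p q : ι, HasDerivAt (fun s : ℝ => (A + s • D)⁻¹ p q) (-((A + s₀ • D)⁻¹ * D * (A + s₀ • D)⁻¹) p q) s₀ := by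
  intro ι _ _ A D s₀ hdet p q
  have hlin : Continuous fun s : ℝ => A + s • D := continuous_const.add (continuous_id.smul continuous_const)
  have hdetc : Continuous fun s : ℝ => (A + s • D).det := hlin.matrix_det
  have hev : ∀ᶠ s in 𝓝 s₀, (A + s • D).det ≠ 0 := hdetc.continuousAt.eventually_ne hdet.ne_zero
  have hinv : ContinuousAt (fun s : ℝ => (A + s • D)⁻¹) s₀ := by
    have h := continuousAt_matrix_inv (A + s₀ • D)
      (by simpa using NormedRing.inverse_continuousAt (Units.mk0 _ hdet.ne_zero))
    exact ContinuousAt.comp (f := fun s : ℝ => A + s • D) (x := s₀) h hlin.continuousAt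
  -- resolvent identity
  have hres : ∀ s : ℝ, (A + s • D).det ≠ 0 →
      (A + s • D)⁻¹ - (A + s₀ • D)⁻¹ = -((s - s₀) • ((A + s • D)⁻¹ * D * (A + s₀ • D)⁻¹)) := by
    intro s hs
    have h1 : (A + s • D)⁻¹ * (A + s • D) = 1 := Matrix.nonsing_inv_mul _ (isUnit_iff_ne_zero.2 hs)
    have h2 : (A + s₀ • D) * (A + s₀ • D)⁻¹ = 1 := Matrix.mul_nonsing_inv _ hdet
    calc (A + s • D)⁻¹ - (A + s₀ • D)⁻¹
        = (A + s • D)⁻¹ * ((A + s₀ • D) * (A + s₀ • D)⁻¹) - ((A + s • D)⁻¹ * (A + s • D)) * (A + s₀ • D)⁻¹ := by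
          rw [h1, h2, Matrix.mul_one, Matrix.one_mul]
      _ = (A + s • D)⁻¹ * (((A + s₀ • D) - (A + s • D)) * (A + s₀ • D)⁻¹) := by
          rw [Matrix.sub_mul, Matrix.mul_sub, Matrix.mul_assoc]
      _ = -((s - s₀) • ((A + s • D)⁻¹ * D * (A + s₀ • D)⁻¹)) := by
          have : (A + s₀ • D) - (A + s • D) = (-(s - s₀)) • D := by
            rw [neg_sub, sub_smul]; abel
          rw [this, Matrix.smul_mul, Matrix.mul_smul, neg_smul, Matrix.mul_assoc]
  -- the slope is eventually `−((A+sD)⁻¹ D (A+s₀D)⁻¹)_{pq}`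
  rw [hasDerivAt_iff_tendsto_slope]
  have hslope : ∀ᶠ s in 𝓝[≠] s₀, slope (fun s : ℝ => (A + s • D)⁻¹ p q) s₀ s =
      -(((A + s • D)⁻¹ * D * (A + s₀ • D)⁻¹) p q) := by
    have hev' : ∀ᶠ s in 𝓝[≠] s₀, (A + s • D).det ≠ 0 ∧ s ≠ s₀ :=
      (eventually_nhdsWithin_of_eventually_nhds hev).and self_mem_nhdsWithin
    refine hev'.mono fun s hs => ?_
    obtain ⟨hs, hne⟩ := hs
    rw [slope_def_field]
    have h := congrFun (congrFun (hres s hs) p) q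
    simp only [Matrix.sub_apply, Matrix.neg_apply, Matrix.smul_apply, smul_eq_mul] at h
    rw [h]
    field_simp [sub_ne_zero.2 hne]
  refine Tendsto.congr' (EventuallyEq.symm hslope) ?_
  -- continuity of the right-hand side at `s₀`
  have hmat : ContinuousAt (fun s : ℝ => (A + s • D)⁻¹ * D * (A + s₀ • D)⁻¹) s₀ :=
    (hinv.mul continuousAt_const).mul continuousAt_const
  have hab : Continuous fun M : Matrix ι ι ℝ => M p q := (continuous_apply q).comp (continuous_apply p)
  have hent : ContinuousAt (fun s : ℝ => ((A + s • D)⁻¹ * D * (A + s₀ • D)⁻¹) p q) s₀ :=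
    ContinuousAt.comp (f := fun s : ℝ => (A + s • D)⁻¹ * D * (A + s₀ • D)⁻¹) (x := s₀) hab.continuousAt hmat
  exact tendsto_nhdsWithin_of_tendsto_nhds hent.neg

/-- **Block factorisation of decoupled Gaussian integrals, explicit form.** If `Q` has no entries
between `S` and `Sᶜ`, `H₁` depends only on the `S`-coordinates and `H₂` only on the others, then
`∫ H₁ H₂ e^{−½φᵀQφ} dφ = (∫ H₁(u ⊕ 0) e^{−½(u⊕0)ᵀQ(u⊕0)} du)(∫ H₂(0 ⊕ v) e^{−½(0⊕v)ᵀQ(0⊕v)} dv)`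
over `(S → ℝ) × (Sᶜ → ℝ)` (Fubini along `MeasurableEquiv.piEquivPiSubtypeProd`; the cross terms of
the form vanish; no integrability hypotheses). [folklore] -/
theorem gaussian_integral_factorizes_explicit :
    ∀ (ι : Type) [Fintype ι] [DecidableEq ι] (Q : Matrix ι ι ℝ) (S : Finset ι), (∀ i j : ι, ¬ (i ∈ S ↔ j ∈ S) → Q i j = 0) → ∀ (H₁ H₂ : (ι → ℝ) → ℝ), (∀ φ ψ : ι → ℝ, (∀ i ∈ S, φ i = ψ i) → H₁ φ = H₁ ψ) → (∀ φ ψ : ι → ℝ, (∀ i, i ∉ S → φ i = ψ i) → H₂ φ = H₂ ψ) → ∫ φ : ι → ℝ, H₁ φ * H₂ φ * Real.exp (-(φ ⬝ᵥ (Q *ᵥ φ)) / 2) = (∫ u : {i // i ∈ S} → ℝ, H₁ (fun i => if h : i ∈ S then u ⟨i, h⟩ else 0) * Real.exp (-((fun i => if h : i ∈ S then u ⟨i, h⟩ else 0) ⬝ᵥ (Q *ᵥ fun i => if h : i ∈ S then u ⟨i, h⟩ else 0)) / 2)) * ∫ v : {i // ¬ i ∈ S} → ℝ, H₂ (fun i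 => if h : i ∈ S then 0 else v ⟨i, h⟩) * Real.exp (-((fun i => if h : i ∈ S then 0 else v ⟨i, h⟩) ⬝ᵥ (Q *ᵥ fun i => if h : i ∈ S then 0 else v ⟨i, h⟩)) / 2) := by
  intro ι _ _ Q S hQ H₁ H₂ h₁ h₂
  set e := MeasurableEquiv.piEquivPiSubtypeProd (fun _ : ι => ℝ) (fun i => i ∈ S) with he
  have hmp : MeasurePreserving e volume volume := by
    have := volume_preserving_piEquivPiSubtypeProd (fun _ : ι => ℝ) (fun i => i ∈ S)
    convert this using 2
    all_goals (congr; try exact Subsingleton.elim _ _)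
  have he_symm : ∀ (z : ({i // i ∈ S} → ℝ) × ({i // ¬ i ∈ S} → ℝ)) (i : ι),
      e.symm z i = if h : i ∈ S then z.1 ⟨i, h⟩ else z.2 ⟨i, h⟩ := by
    intro z i
    simp only [he, MeasurableEquiv.piEquivPiSubtypeProd, MeasurableEquiv.symm_mk, MeasurableEquiv.coe_mk,
      Equiv.piEquivPiSubtypeProd_symm_apply]
  -- the two partial extensions by zero
  set X₁ : ({i // i ∈ S} → ℝ) → (ι → ℝ) := fun u i => if h : i ∈ S then u ⟨i, h⟩ else 0 with hX₁
  set X₂ : ({i // ¬ i ∈ S} → ℝ) → (ι → ℝ) := fun v i => if h : i ∈ S then 0 else v ⟨i, h⟩ with hX₂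
  have hsplit : ∀ z : ({i // i ∈ S} → ℝ) × ({i // ¬ i ∈ S} → ℝ), e.symm z = X₁ z.1 + X₂ z.2 := by
    intro z; funext i
    rw [he_symm, Pi.add_apply, hX₁, hX₂]
    by_cases h : i ∈ S <;> simp [h]
  have hH₁ : ∀ z : ({i // i ∈ S} → ℝ) × ({i // ¬ i ∈ S} → ℝ), H₁ (e.symm z) = H₁ (X₁ z.1) := fun z =>
    h₁ _ _ fun i hi => by rw [he_symm, hX₁]; simp [hi]
  have hH₂ : ∀ z : ({i // i ∈ S} → ℝ) × ({i // ¬ i ∈ S} → ℝ), H₂ (e.symm z) = H₂ (X₂ z.2) := fun z =>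
    h₂ _ _ fun i hi => by rw [he_symm, hX₂]; simp [hi]
  -- the cross terms of the quadratic form vanish
  have hcross₁ : ∀ (u : {i // i ∈ S} → ℝ) (v : {i // ¬ i ∈ S} → ℝ), X₁ u ⬝ᵥ (Q *ᵥ X₂ v) = 0 := by
    intro u v
    simp only [dotProduct, Matrix.mulVec]
    refine Finset.sum_eq_zero fun i _ => ?_
    by_cases hi : i ∈ S
    · rw [Finset.sum_eq_zero fun j _ => ?_, mul_zero]
      by_cases hj : j ∈ S
      · simp [hX₂, hj]
      · rw [hQ i j (by simp [hi, hj]), zero_mul]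
    · simp [hX₁, hi]
  have hcross₂ : ∀ (u : {i // i ∈ S} → ℝ) (v : {i // ¬ i ∈ S} → ℝ), X₂ v ⬝ᵥ (Q *ᵥ X₁ u) = 0 := by
    intro u v
    simp only [dotProduct, Matrix.mulVec]
    refine Finset.sum_eq_zero fun i _ => ?_
    by_cases hi : i ∈ S
    · simp [hX₂, hi]
    · rw [Finset.sum_eq_zero fun j _ => ?_, mul_zero]
      by_cases hj : j ∈ S
      · rw [hQ i j (by simp [hi, hj]), zero_mul]
      · simp [hX₁, hj]
  have hquad : ∀ z : ({i // i ∈ S} → ℝ) × ({i // ¬ i ∈ S} → ℝ),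
      e.symm z ⬝ᵥ (Q *ᵥ e.symm z) = X₁ z.1 ⬝ᵥ (Q *ᵥ X₁ z.1) + X₂ z.2 ⬝ᵥ (Q *ᵥ X₂ z.2) := by
    intro z
    rw [hsplit z, Matrix.mulVec_add, add_dotProduct, dotProduct_add, dotProduct_add, hcross₁, hcross₂]
    ring
  -- change variables and apply Fubini
  have h1 : ∫ φ : ι → ℝ, H₁ φ * H₂ φ * Real.exp (-(φ ⬝ᵥ (Q *ᵥ φ)) / 2) =
      ∫ z, H₁ (e.symm z) * H₂ (e.symm z) * Real.exp (-(e.symm z ⬝ᵥ (Q *ᵥ e.symm z)) / 2) := by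
    rw [← hmp.symm.integral_comp' (g := fun φ => H₁ φ * H₂ φ * Real.exp (-(φ ⬝ᵥ (Q *ᵥ φ)) / 2))]
  rw [h1, Measure.volume_eq_prod]
  have h2 : ∀ z : ({i // i ∈ S} → ℝ) × ({i // ¬ i ∈ S} → ℝ),
      H₁ (e.symm z) * H₂ (e.symm z) * Real.exp (-(e.symm z ⬝ᵥ (Q *ᵥ e.symm z)) / 2) =
        (H₁ (X₁ z.1) * Real.exp (-(X₁ z.1 ⬝ᵥ (Q *ᵥ X₁ z.1)) / 2)) *
          (H₂ (X₂ z.2) * Real.exp (-(X₂ z.2 ⬝ᵥ (Q *ᵥ X₂ z.2)) / 2)) := by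
    intro z
    rw [hH₁, hH₂, hquad, neg_add, add_div, Real.exp_add]
    ring
  simp_rw [h2]
  exact integral_prod_mul (μ := (volume : Measure ({i // i ∈ S} → ℝ)))
    (ν := (volume : Measure ({i // ¬ i ∈ S} → ℝ)))
    (fun u => H₁ (X₁ u) * Real.exp (-(X₁ u ⬝ᵥ (Q *ᵥ X₁ u)) / 2))
    (fun v => H₂ (X₂ v) * Real.exp (-(X₂ v ⬝ᵥ (Q *ᵥ X₂ v)) / 2))


/-- **Locality of block-decoupled Gaussian expectations.** If two positive definite precision
matrices `Q, Q'` on `ι → ℝ` both have no entries between `S` and `Sᶜ` and agree on `S × S`, then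
every `S`-local observable has the same expectation under both Gaussians: the marginal of a
decoupled block is the block's own Gaussian, whatever happens outside.  In the decoupling expansion
this is why the activity of a polymer depends only on the polymer. [folklore] -/
theorem gaussian_expect_local :
    ∀ (ι : Type) [Fintype ι] [DecidableEq ι] (Q Q' : Matrix ι ι ℝ) (S : Finset ι), Q.PosDef → Q'.PosDef → (∀ i j : ι, ¬ (i ∈ S ↔ j ∈ S) → Q i j = 0) → (∀ i j : ι, ¬ (i ∈ S ↔ j ∈ S) → Q' i j = 0) → (∀ i ∈ S, ∀ j ∈ S, Q i j = Q' i j) → ∀ F : (ι → ℝ) → ℝ, (∀ φ ψ : ι → ℝ, (∀ i ∈ S, φ i = ψ i) → F φ = F ψ) → (∫ φ : ι → ℝ, F φ * Real.exp (-(φ ⬝ᵥ (Q *ᵥ φ)) / 2)) / (∫ φ : ι → ℝ, Real.exp (-(φ ⬝ᵥ (Q *ᵥ φ)) / 2)) = (∫ φ : ι → ℝ, F φ * Real.exp (-(φ ⬝ᵥ (Q' *ᵥ φ)) / 2)) / (∫ φ : ι → ℝ, Real.exp (-(φ ⬝ᵥ (Q' *ᵥ φ)) / 2)) := by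
  intro ι _ _ Q Q' S hQ hQ' hQ0 hQ'0 hagree F hF
  -- the `S`-block forms of `Q` and `Q'` agree
  have hform : ∀ u : {i // i ∈ S} → ℝ,
      (fun i => if h : i ∈ S then u ⟨i, h⟩ else 0) ⬝ᵥ (Q *ᵥ fun i => if h : i ∈ S then u ⟨i, h⟩ else 0) =
        (fun i => if h : i ∈ S then u ⟨i, h⟩ else 0) ⬝ᵥ (Q' *ᵥ fun i => if h : i ∈ S then u ⟨i, h⟩ else 0) := by
    intro u
    simp only [dotProduct, Matrix.mulVec]
    refine Finset.sum_congr rfl fun i _ => ?_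
    by_cases hi : i ∈ S
    · congr 1
      refine Finset.sum_congr rfl fun j _ => ?_
      by_cases hj : j ∈ S
      · rw [hagree i hi j hj]
      · simp [hj]
    · simp [hi]
  have h1 := fun (G : (ι → ℝ) → ℝ) (hG : ∀ φ ψ : ι → ℝ, (∀ i ∈ S, φ i = ψ i) → G φ = G ψ) =>
    gaussian_integral_factorizes_explicit ι Q S hQ0 G (fun _ => 1) hG (fun _ _ _ => rfl)
  have h1' := fun (G : (ι → ℝ) → ℝ) (hG : ∀ φ ψ : ι → ℝ, (∀ i ∈ S, φ i = ψ i) → G φ = G ψ) =>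
    gaussian_integral_factorizes_explicit ι Q' S hQ'0 G (fun _ => 1) hG (fun _ _ _ => rfl)
  have hFQ := h1 F hF
  have h1Q := h1 (fun _ => 1) (fun _ _ _ => rfl)
  have hFQ' := h1' F hF
  have h1Q' := h1' (fun _ => 1) (fun _ _ _ => rfl)
  simp only [one_mul, mul_one] at hFQ h1Q hFQ' h1Q'
  -- the outside factors are non-zero (the full partition functions are positive)
  have hZ := (gaussian_second_moment ι Q hQ).1
  have hZ' := (gaussian_second_moment ι Q' hQ').1
  rw [h1Q] at hZ
  rw [h1Q'] at hZ'
  have hB : (∫ v : {i // ¬ i ∈ S} → ℝ, Real.exp (-((fun i => if h : i ∈ S then 0 else v ⟨i, h⟩) ⬝ᵥ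
      (Q *ᵥ fun i => if h : i ∈ S then 0 else v ⟨i, h⟩)) / 2)) ≠ 0 := by
    intro h; rw [h, mul_zero] at hZ; exact lt_irrefl _ hZ
  have hB' : (∫ v : {i // ¬ i ∈ S} → ℝ, Real.exp (-((fun i => if h : i ∈ S then 0 else v ⟨i, h⟩) ⬝ᵥ
      (Q' *ᵥ fun i => if h : i ∈ S then 0 else v ⟨i, h⟩)) / 2)) ≠ 0 := by
    intro h; rw [h, mul_zero] at hZ'; exact lt_irrefl _ hZ'
  rw [hFQ, h1Q, hFQ', h1Q', mul_div_mul_right _ _ hB, mul_div_mul_right _ _ hB']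
  simp_rw [hform]

end Summit.QuantumFields.YangMills.Theorems.AnchorGap

end
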